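import Literature.AnabelianGeometry.AbsoluteAnabelian.GaloisCyclotomeAction
import Literature.AnabelianGeometry.EtaleTheta.CyclotomeHomQmodZ
import HarnessLib

/-!
# [AbsTopIII] Cor. 1.10 (i)(a) «`μ_Ẑ(G_k) := Hom(ℚ/ℤ, μ_{ℚ/ℤ}(G_k))`» — literally

S. Mochizuki, *Topics in absolute anabelian geometry III*, Cor. 1.10 (i)(a) p. 41: «Write:
`μ_{ℚ/ℤ}(G_k) := lim_{→H} (H^ab)_tors`; `μ_Ẑ(G_k) := Hom(ℚ/ℤ, μ_{ℚ/ℤ}(G_k))`»; Def. 3.1 (v) p. 69;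
Prop. 3.2 (i) p. 71 «applying the functor `Hom(ℚ/ℤ, −)`».  The tree's `muZhat G` (abc-iut-L4-t1,
`GaloisCyclotome.lean`) is `EtaleTheta.cyclotome (Multiplicative (muQZ G))` = `lim_n μ_{ℚ/ℤ}(G)[n]`, «realised
— up to the canonical isomorphism `Hom(ℚ/ℤ, A) ≅ lim_n A[n]`» (its docstring).  JUNCTION FILE (no new
notion; named specialisations, all constructed):

* `muZhatEquivHomQmodZ G : μ_Ẑ(G) ≃* Hom(ℚ/ℤ, μ_{ℚ/ℤ}(G))` — the printed definition, by name, as the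
  inverse of `EtaleTheta.cyclotome.homQmodZEquiv` (`CyclotomeHomQmodZ.lean`); `G`-equivariant for the
  conjugation action (`muZhatEquivHomQmodZ_smul`) and natural in `G ≃ₜ* G'` (`muZhatEquivHomQmodZ_map`);
* (sequel file `GaloisCyclotomeQmodZZHat.lean`: the coherence `Λ(ℚ/ℤ) ≅ End(ℚ/ℤ) ≅ Ẑ` with
  `ZHatCompletion.endAddCircleEquiv` of `MonoidKummerMapsEndQmodZ.lean`.)

HONEST FRAMING: classical; nothing here bears on [IUTchIII] Cor. 3.12; no side taken.
-/

noncomputable section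

namespace Literature.AnabelianGeometry.EtaleTheta.cyclotome

universe u

variable {A : Type u} [CommGroup A]

/-- Naturality of the inverse `toHom`: `toHom (Λ(ψ) ζ) = ψ ∘ toHom ζ`.
[cite: MochizukiAbsTopIII2015, Definition 3.1 (v) p.69] -/
theorem toHom_map {B : Type*} [CommGroup B] (ψ : A →* B) (ζ : cyclotome A) :
    toHom (map ψ ζ) = ψ.comp (toHom ζ) := by
  apply ofHom_injective
  rw [ofHom_toHom, ← map_ofHom, ofHom_toHom]

end Literature.AnabelianGeometry.EtaleTheta.cyclotome

namespace Literature.AnabelianGeometry.AbsoluteAnabelian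

open EtaleTheta

universe u

section MuZhat

variable (G : Type u) [Group G] [TopologicalSpace G] [IsTopologicalGroup G] [CompactSpace G]

/-- **`μ_Ẑ(G) = Hom(ℚ/ℤ, μ_{ℚ/ℤ}(G))`** ([AbsTopIII] Cor. 1.10 (i)(a), Def. 3.1 (v)): the tree's
`muZhat G = lim_n μ_{ℚ/ℤ}(G)[n]` identified with the printed definition (`ℚ/ℤ = AddCircle (1 : ℚ)`, both
read multiplicatively). CONSTRUCTED (= `cyclotome.homQmodZEquiv.symm`).
[cite: MochizukiAbsTopIII2015, Cor 1.10 (i) p.41] -/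
def muZhatEquivHomQmodZ :
    muZhat G ≃* (Multiplicative (AddCircle (1 : ℚ)) →* Multiplicative (muQZ G)) :=
  (cyclotome.homQmodZEquiv (A := Multiplicative (muQZ G))).symm

variable {G}

/-- `muZhatEquivHomQmodZ` evaluated at `1/n` returns the `n`-th component.
[cite: MochizukiAbsTopIII2015, Cor 1.10 (i) p.41] -/
@[simp] theorem muZhatEquivHomQmodZ_apply_ofAdd_inv (ζ : muZhat G) (n : ℕ+) :
    muZhatEquivHomQmodZ G ζ (Multiplicative.ofAdd ((((1 : ℚ) / (n : ℕ) : ℚ) : AddCircle (1 : ℚ)))) =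
      (ζ : ℕ+ → Multiplicative (muQZ G)) n := by
  have h : muZhatEquivHomQmodZ G ζ = cyclotome.toHom (A := Multiplicative (muQZ G)) ζ :=
    cyclotome.homQmodZEquiv_symm_apply (A := Multiplicative (muQZ G)) ζ
  rw [h]
  exact cyclotome.toHom_ofAdd_inv (A := Multiplicative (muQZ G)) ζ n

/-- **Equivariance**: the conjugation action of `G` on `μ_Ẑ(G)` (componentwise, `GaloisCyclotomeAction`)
corresponds to post-composition with the action on `μ_{ℚ/ℤ}(G)` — `Hom(ℚ/ℤ, μ_{ℚ/ℤ}(G)) ≅ μ_Ẑ(G)` is an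
isomorphism of `G`-modules. [cite: MochizukiAbsTopIII2015, Cor 1.10 (i) p.42] -/
theorem muZhatEquivHomQmodZ_smul (g : G) (ζ : muZhat G) :
    muZhatEquivHomQmodZ G (g • ζ) =
      (MulDistribMulAction.toMonoidHom (Multiplicative (muQZ G)) g).comp (muZhatEquivHomQmodZ G ζ) := by
  have h : ∀ ξ : muZhat G, muZhatEquivHomQmodZ G ξ = cyclotome.toHom (A := Multiplicative (muQZ G)) ξ :=
    fun ξ => cyclotome.homQmodZEquiv_symm_apply (A := Multiplicative (muQZ G)) ξ
  rw [h, h]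
  exact cyclotome.toHom_smul (A := Multiplicative (muQZ G)) g ζ

/-- **Naturality in `G`**: transport along `e : G ≃ₜ* G'` (`muZhat.map e`, componentwise `muQZ.map e`)
corresponds to post-composition with `μ_{ℚ/ℤ}(e)`. [cite: MochizukiAbsTopIII2015, Cor 1.10 (i) p.42] -/
theorem muZhatEquivHomQmodZ_map {G' : Type u} [Group G'] [TopologicalSpace G'] [IsTopologicalGroup G']
    [CompactSpace G'] (e : G ≃ₜ* G') (ζ : muZhat G) :
    muZhatEquivHomQmodZ G' (muZhat.map e ζ) =
      (AddMonoidHom.toMultiplicative (muQZ.map e)).comp (muZhatEquivHomQmodZ G ζ) := by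
  have h : muZhatEquivHomQmodZ G ζ = cyclotome.toHom (A := Multiplicative (muQZ G)) ζ :=
    cyclotome.homQmodZEquiv_symm_apply (A := Multiplicative (muQZ G)) ζ
  have h' : muZhatEquivHomQmodZ G' (muZhat.map e ζ) =
      cyclotome.toHom (A := Multiplicative (muQZ G')) (muZhat.map e ζ) :=
    cyclotome.homQmodZEquiv_symm_apply (A := Multiplicative (muQZ G')) _
  rw [h, h']
  exact cyclotome.toHom_map (AddMonoidHom.toMultiplicative (muQZ.map e)) ζ

end MuZhat

end Literature.AnabelianGeometry.AbsoluteAnabelian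

end
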